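import Literature.Algebra.EuclideanDomain.EuclideanOrderTypeFinite
import Literature.Algebra.EuclideanDomain.NormalisedEuclideanAlgorithm
import Literature.RingTheory.PrincipalIdealRing.SpecialPrincipalIdealRings
import HarnessLib

/-!
# Euclidean rings of order type at most `ω`: `R/(x)` is Artinian, `R` is a PID or an Artinian principal ring, Artinian
# rings have finite order type, and `e(R) = ω` forces a domain (Clark 2015 Thm. 16, Cor. 17; Fletcher 1971)

Topic `Literature/Algebra/EuclideanDomain`, namespace `Literature.Algebra.EuclideanDomain`.  THEOREMS ONLY (no `def`, no
instance, no named fact), all proved, in the vocabulary of `TransfiniteSmallestAlgorithm.lean` (`samuelSet R α = A_α`,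
`samuelRank = θ`; «`R` is Euclidean» = the transfinite construction exhausts `R`, hypothesis `h`) and
`EuclideanOrderTypeIndecomposable.lean` (`e(R) = ⨆ z, ((θ z − 1) + 1)`), on top of the structure theory of principal
ideal rings (`Literature/RingTheory/PrincipalIdealRing/`: Zariski–Samuel's Theorem 33 `decomposition`, special PIRs,
`finite_ideal_of_isArtinianRing`).  Completes `EuclideanOrderTypeFinite.lean`, whose `TODO(general form)` this is («the
conversions “Artinian principal ⟹ finitely many ideals” and “DCC on principal ideals of the principal ring `R/(x)` ⟹
`IsArtinianRing (R ⧸ (x))`”, and Cor. 17 (b) ∕ Thm. 16 (b) (structure theorem) are not done here»).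

## Source (read at the page)

P. L. Clark, *A note on Euclidean order types*, Order **32** (2015) 157–178 [Clark2015EuclideanOrderTypes] (materialised
`paper:arxiv-1208.0977`, arXiv numbering; `p0005.txt`), VERBATIM.  **Theorem 16.** «Suppose `R` is Euclidean with
`e(R) ≤ ω`.  Then: a) For all `x ∈ R•`, `R/(x)` is Artinian.  b) `R` is either a PID or an Artinian principal ring.  Proof.
a) If `R/(x)` were not Artinian, there would be a sequence of elements `{x_n}` in `R` with `x₀ = x` and `(x_{n+1}) ⊊ (x_n)`
for all `n ∈ ℕ`.  Applying Corollary 12 b) we get `φ(x) = φ(x₀) > φ(x₁) > … > φ(x_n) > …`, contradicting `φ(x) ∈ ω`.  b) This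
follows immediately from Theorem 13» (= Zariski–Samuel's structure theorem: «a) A PIR is the direct product of a finite
number of PID's and Artinian local PIR's. b) every quotient of a PIR is a PIR; any finite product of PIR's is a PIR. c) every
Artinian local PIR is a quotient of a PID.»).  **Corollary 17 (Fletcher [Fletcher71]).** «a) If `A` is an Artinian
Euclidean ring, then `e(A) < ω`.  b) A Euclidean ring `R` with `e(R) = ω` is a domain.  Proof. a) The value of `φ_A` at
`x ∈ R` depends only on the ideal `(x)`.  But an Artinian principal ring has only finitely many ideals!  So `e(R) < ω`.
b) This follows immediately from Theorem 16 b) and part a).»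

## What is formalised

* §1 **Thm. 16 (a)**: if `R` is exhausted by its transfinite construction and `θ(x) < ω`, `x ≠ 0`, then `R/(x)` is an
  Artinian ring (`isArtinianRing_quotient_span_singleton`): the tree's chain form `not_exists_chain_of_samuelRank_lt_omega0`
  (no strictly descending chain of principal ideals above `x`) plus «`R` is a PIR» (Samuel's Prop. 3,
  `Algorithm.isPrincipalIdealRing`) so that every ideal of `R/(x)` comes from a principal ideal above `x`.
* §2 **Cor. 17 (a)**: an Artinian ring exhausted by its transfinite construction has `e(R) < ω`
  (`iSup_samuelRank_lt_omega0_of_isArtinianRing`) — «an Artinian principal ring has only finitely many ideals»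
  (`finite_ideal_of_isArtinianRing`) fed into the tree's `iSup_samuelRank_lt_omega0_of_finite_setOf_span_singleton`.
* §3 **Thm. 16 (b)**: if `R` is exhausted with all `θ(z) < ω` then `R` is a domain (so a PID) or an Artinian (principal)
  ring (`isDomain_or_isArtinianRing_of_forall_samuelRank_lt_omega0`).  Via Theorem 33 `R ≅ ∏_𝔭 R/𝔭^N`: with a single
  minimal prime this is `isDomain_or_of_subsingleton_minimalPrimes`; with two, each factor `R/𝔭^N` is a quotient of
  `R/(f)` for the idempotent-like `f ≠ 0` vanishing exactly at `𝔭`, which is Artinian by §1.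
* §4 **Cor. 17 (b) = Cor. 26 (Fletcher): a Euclidean ring with `e(R) = ω` is a domain**
  (`isDomain_of_iSup_samuelRank_eq_omega0`), and `e(R) ≤ ω` already gives «PID or Artinian»
  (`isDomain_or_isArtinianRing_of_iSup_samuelRank_le_omega0`).

## Mathlib / tree search

Mathlib: `isArtinian_iff`, `wellFounded_iff_isEmpty_descending_chain`, `Ideal.comap_injective_of_surjective`,
`Function.Surjective.isArtinianRing`, `Ideal.Quotient.lift_surjective_of_surjective`, the instance `IsArtinianRing (Π i, R i)`.
Tree: `EuclideanOrderTypeFinite.lean` (`not_exists_chain_of_samuelRank_lt_omega0`,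
`iSup_samuelRank_lt_omega0_of_finite_setOf_span_singleton`), `EuclideanOrderTypeIndecomposable.lean` (`samuelRank_sub_one_lt_iSup`),
`TransfiniteSmallestAlgorithm.lean` (`samuelRank_isAlgorithm`), `NormalisedEuclideanAlgorithm.lean` (`Algorithm.isPrincipalIdealRing`),
`Literature/RingTheory/PrincipalIdealRing/` (`exists_nilradical_pow_eq_bot`, `bijective_pi_quotient_pow`,
`isDomain_or_of_subsingleton_minimalPrimes`, `finite_ideal_of_isArtinianRing`).
-/

namespace Literature.Algebra.EuclideanDomain

open Ordinal Literature.RingTheory.PrincipalIdealRing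

universe u

variable {R : Type u} [CommRing R]

/-! ## §1 Thm. 16 (a): `θ(x) < ω` makes `R/(x)` Artinian -/

/-- **Thm. 16 (a)** «Suppose `R` is Euclidean with `e(R) ≤ ω`.  Then for all `x ∈ R•`, `R/(x)` is Artinian» — for `R`
exhausted by its transfinite construction it suffices that `θ(x) < ω`: a strictly descending chain of ideals of the
principal ring `R/(x)` would come from a strictly descending chain of principal ideals `(y_n) ∋ x`, along which `θ` increases
strictly (the tree's chain form). [cite: Clark2015EuclideanOrderTypes, Thm. 16 (a)] -/
theorem isArtinianRing_quotient_span_singleton (h : ∀ z : R, ∃ α : Ordinal.{u}, z ∈ samuelSet R α) {x : R} (hx0 : x ≠ 0)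
    (hω : samuelRank x < ω) : IsArtinianRing (R ⧸ Ideal.span ({x} : Set R)) := by
  haveI := Algorithm.isPrincipalIdealRing (samuelRank_isAlgorithm h)
  rw [isArtinianRing_iff, isArtinian_iff, wellFounded_iff_isEmpty_descending_chain]
  refine ⟨fun ⟨f, hf⟩ ↦ ?_⟩
  -- pull the chain back to principal ideals of `R` containing `x`
  set J : ℕ → Ideal R := fun n ↦ Ideal.comap (Ideal.Quotient.mk (Ideal.span {x})) (f n) with hJ
  have hJy : ∀ n, ∃ y : R, J n = Ideal.span {y} := fun n ↦ by
    obtain ⟨y, hy⟩ := (IsPrincipalIdealRing.principal (J n)).principal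
    exact ⟨y, hy⟩
  choose y hy using hJy
  have hxJ : ∀ n, x ∈ J n := fun n ↦
    Ideal.mem_comap.2 (by rw [Ideal.Quotient.eq_zero_iff_mem.2 (Ideal.mem_span_singleton_self x)]; exact (f n).zero_mem)
  refine not_exists_chain_of_samuelRank_lt_omega0 hx0 (h x) hω ⟨y, fun n ↦ ?_, fun n ↦ ?_⟩
  · exact Ideal.mem_span_singleton.1 (hy n ▸ hxJ n)
  · rw [← hy, ← hy]
    refine lt_of_le_of_ne (Ideal.comap_mono (hf n).le) fun heq ↦ (hf n).ne ?_
    exact Ideal.comap_injective_of_surjective _ Ideal.Quotient.mk_surjective heq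

/-- Thm. 16 (a) for a SMALL Euclidean ring (all `θ(z) < ω`): every `R/(x)`, `x ≠ 0`, is Artinian.
[cite: Clark2015EuclideanOrderTypes, Thm. 16 (a)] -/
theorem isArtinianRing_quotient_span_singleton_of_forall (h : ∀ z : R, ∃ α : Ordinal.{u}, z ∈ samuelSet R α)
    (hω : ∀ z : R, samuelRank z < ω) {x : R} (hx0 : x ≠ 0) : IsArtinianRing (R ⧸ Ideal.span ({x} : Set R)) :=
  isArtinianRing_quotient_span_singleton h hx0 (hω x)

/-! ## §2 Cor. 17 (a): Artinian Euclidean rings have finite order type -/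

/-- **Cor. 17 (a) (Fletcher): «If `A` is an Artinian Euclidean ring, then `e(A) < ω`»** — «an Artinian principal ring has only
finitely many ideals!», and `θ` depends only on the principal ideal. [cite: Clark2015EuclideanOrderTypes, Cor. 17 (a)] -/
theorem iSup_samuelRank_lt_omega0_of_isArtinianRing [IsArtinianRing R] (h : ∀ z : R, ∃ α : Ordinal.{u}, z ∈ samuelSet R α) :
    (⨆ z : R, (samuelRank z - 1 + 1)) < ω := by
  haveI := Algorithm.isPrincipalIdealRing (samuelRank_isAlgorithm h)
  haveI := finite_ideal_of_isArtinianRing (R := R)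
  exact iSup_samuelRank_lt_omega0_of_finite_setOf_span_singleton h (Set.toFinite _)

/-- Hence every `θ(z)` is finite in an Artinian Euclidean ring. [cite: Clark2015EuclideanOrderTypes, Cor. 17 (a)] -/
theorem samuelRank_lt_omega0_of_isArtinianRing [IsArtinianRing R] (h : ∀ z : R, ∃ α : Ordinal.{u}, z ∈ samuelSet R α)
    (z : R) : samuelRank z < ω := by
  have h1 : samuelRank z - 1 < ω := (samuelRank_sub_one_lt_iSup z).trans (iSup_samuelRank_lt_omega0_of_isArtinianRing h)
  obtain ⟨m, hm⟩ := Ordinal.lt_omega0.1 h1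
  calc samuelRank z ≤ 1 + (samuelRank z - 1) := Ordinal.le_add_sub _ _
    _ = ((1 + m : ℕ) : Ordinal.{u}) := by rw [hm, Nat.cast_add, Nat.cast_one]
    _ < ω := Ordinal.natCast_lt_omega0 _

/-! ## §3 Thm. 16 (b): a small Euclidean ring is a PID or an Artinian principal ring -/

/-- If `e(R) ≤ ω` — i.e. every `θ(z)` is finite — then every `θ(z) < ω` (the form used below), and conversely.
[cite: Clark2015EuclideanOrderTypes, Thm. 16] -/
theorem forall_samuelRank_lt_omega0_iff_iSup_le :
    (∀ z : R, samuelRank z < ω) ↔ (⨆ z : R, (samuelRank z - 1 + 1)) ≤ ω := by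
  constructor
  · intro hω
    refine Ordinal.iSup_le fun z ↦ ?_
    obtain ⟨m, hm⟩ := Ordinal.lt_omega0.1 (lt_of_le_of_lt (Ordinal.sub_le_self _ _) (hω z))
    rw [hm]
    exact_mod_cast (Ordinal.natCast_lt_omega0 (m + 1)).le
  · intro hle z
    have h1 : samuelRank z - 1 < ω := (samuelRank_sub_one_lt_iSup z).trans_le hle
    obtain ⟨m, hm⟩ := Ordinal.lt_omega0.1 h1
    calc samuelRank z ≤ 1 + (samuelRank z - 1) := Ordinal.le_add_sub _ _
      _ = ((1 + m : ℕ) : Ordinal.{u}) := by rw [hm, Nat.cast_add, Nat.cast_one]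
      _ < ω := Ordinal.natCast_lt_omega0 _

/-- **Thm. 16 (b)** «`R` is either a PID or an Artinian principal ring» for `R` Euclidean (exhausted by its transfinite
construction, hence a PIR) with all `θ(z) < ω`.  Proof through Zariski–Samuel's Theorem 33, `R ≅ ∏_𝔭 R/𝔭^N` over the minimal
primes: one minimal prime — `R` is a domain or a special (Artinian) PIR; at least two — for each `𝔭` the element `f` with
coordinates `0` at `𝔭` and `1` elsewhere is non-zero, `R/(f)` is Artinian by Thm. 16 (a) and maps onto `R/𝔭^N`, so every
factor, hence `R`, is Artinian. [cite: Clark2015EuclideanOrderTypes, Thm. 16 (b)] -/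
theorem isDomain_or_isArtinianRing_of_forall_samuelRank_lt_omega0 (h : ∀ z : R, ∃ α : Ordinal.{u}, z ∈ samuelSet R α)
    (hω : ∀ z : R, samuelRank z < ω) : IsDomain R ∨ IsArtinianRing R := by
  classical
  haveI := Algorithm.isPrincipalIdealRing (samuelRank_isAlgorithm h)
  rcases subsingleton_or_nontrivial R with hR | hR
  · exact Or.inr inferInstance
  by_cases hsub : (minimalPrimes R).Subsingleton
  · exact (isDomain_or_of_subsingleton_minimalPrimes hsub).imp id And.right
  -- at least two minimal primes: every factor of the decomposition is Artinian
  obtain ⟨N, hN, hnil⟩ := exists_nilradical_pow_eq_bot (R := R)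
  haveI : Finite ↥(minimalPrimes R) := (minimalPrimes.finite_of_isNoetherianRing R).to_subtype
  let e := RingEquiv.ofBijective _ (bijective_pi_quotient_pow (R := R) hnil)
  have hfac : ∀ q : ↥(minimalPrimes R), IsArtinianRing (R ⧸ (q.1 ^ N : Ideal R)) := by
    intro q
    obtain ⟨q', hq'⟩ : ∃ q' : ↥(minimalPrimes R), q' ≠ q := by
      by_contra hnone
      push Not at hnone
      exact hsub fun a ha b hb ↦ by
        have ha' := hnone ⟨a, ha⟩
        have hb' := hnone ⟨b, hb⟩
        exact (congrArg Subtype.val ha').trans (congrArg Subtype.val hb').symm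
    -- the element with coordinate `0` at `q` and `1` elsewhere
    let g : ∀ r : ↥(minimalPrimes R), R ⧸ (r.1 ^ N : Ideal R) := fun r ↦ if r = q then 0 else 1
    obtain ⟨f, hf⟩ := e.surjective g
    have hnt : Nontrivial (R ⧸ (q'.1 ^ N : Ideal R)) := Ideal.Quotient.nontrivial_iff.2
      (ne_top_of_le_ne_top (IsMinimalPrime.isPrime q'.2).ne_top (Ideal.pow_le_self (Nat.pos_iff_ne_zero.1 hN)))
    have hf0 : f ≠ 0 := by
      intro hf0
      have h1 : g q' = 1 := if_neg hq'
      have h0 : g q' = 0 := by rw [← hf, hf0, map_zero]; rfl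
      exact one_ne_zero (h1.symm.trans h0)
    haveI := isArtinianRing_quotient_span_singleton h hf0 (hω f)
    -- `R/(f) → R/q^N`, induced by the `q`-th coordinate of `e`, is surjective
    let ψ : R →+* R ⧸ (q.1 ^ N : Ideal R) := (Pi.evalRingHom _ q).comp e.toRingHom
    have hψ : Function.Surjective ψ := (Function.surjective_eval q).comp e.surjective
    have hψf : ∀ a ∈ Ideal.span ({f} : Set R), ψ a = 0 := fun a ha ↦ by
      obtain ⟨c, rfl⟩ := Ideal.mem_span_singleton'.1 ha
      have : ψ f = 0 := by
        show (e f) q = 0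
        rw [hf]
        exact if_pos rfl
      rw [map_mul, this, mul_zero]
    exact (Ideal.Quotient.lift_surjective_of_surjective (Ideal.span {f}) hψf hψ).isArtinianRing
  haveI : ∀ q : ↥(minimalPrimes R), IsArtinianRing (R ⧸ (q.1 ^ N : Ideal R)) := hfac
  exact Or.inr e.symm.isArtinianRing

/-- Thm. 16 (b) with the hypothesis as printed, `e(R) ≤ ω`. [cite: Clark2015EuclideanOrderTypes, Thm. 16 (b)] -/
theorem isDomain_or_isArtinianRing_of_iSup_samuelRank_le_omega0 (h : ∀ z : R, ∃ α : Ordinal.{u}, z ∈ samuelSet R α)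
    (hω : (⨆ z : R, (samuelRank z - 1 + 1)) ≤ ω) : IsDomain R ∨ IsArtinianRing R :=
  isDomain_or_isArtinianRing_of_forall_samuelRank_lt_omega0 h (forall_samuelRank_lt_omega0_iff_iSup_le.2 hω)

/-! ## §4 Cor. 17 (b) = Cor. 26 (Fletcher): `e(R) = ω` forces a domain -/

/-- **Cor. 17 (b) ∕ Cor. 26 (Fletcher): «A Euclidean ring `R` with `e(R) = ω` is a domain»** — by Thm. 16 (b) it is a domain
or Artinian, and Artinian rings have `e(R) < ω` (Cor. 17 (a)). [cite: Clark2015EuclideanOrderTypes, Cor. 17 (b) and Cor. 26] -/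
theorem isDomain_of_iSup_samuelRank_eq_omega0 (h : ∀ z : R, ∃ α : Ordinal.{u}, z ∈ samuelSet R α)
    (hω : (⨆ z : R, (samuelRank z - 1 + 1)) = ω) : IsDomain R := by
  rcases isDomain_or_isArtinianRing_of_iSup_samuelRank_le_omega0 h hω.le with hdom | hart
  · exact hdom
  · exact absurd hω (iSup_samuelRank_lt_omega0_of_isArtinianRing h).ne

end Literature.Algebra.EuclideanDomain
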